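import Literature.AlgebraicGeometry.Motives.HodgeLieCentreTrivialOfTotallyRealCentre
import Literature.AlgebraicGeometry.Motives.HodgeStructureEndAlgPositiveInvolution
import Literature.AlgebraicGeometry.Motives.MumfordTateLieAlgebraEqHodgeLie
import Literature.RingTheory.CentralSimple.AlbertTypesSymmetricElements
import Literature.RingTheory.ZeroDimensional.FaithfulModuleDegreeBound
import HarnessLib

/-!
# «`dim M_φ ≤ ½ dim Z(E_φ)`» FOR EVERY POLARIZABLE CM-HODGE STRUCTURE: the Hodge Lie algebra of a polarizable `ℚ`-Hodge
# structure with `Lie Hg ⊂ E_φ` (the tree's CM notion) lies in the `(−1)`-eigenspace of the Rosati involution on the CENTRE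
# `Z(E_φ)`, a reduced commutative algebra, hence `2 · dim Hg(V) ≤ dim_ℚ Z(E_φ)` and `2 · dim M_φ̃ ≤ dim_ℚ Z(E_φ) + 2`
# (Milne, *Lefschetz classes*, §1 p. 645 and §4 p. 660; Green–Griffiths–Kerr §V.D p. 164)

[topic AlgebraicGeometry/Motives]

Layer `Literature/AlgebraicGeometry/Motives`, lane `lit-hodgefound` (Track 2 foundations library; seat `lit-hodgefound-p02`, gen 38,
row g38-#8 = pointer (C) of gen 37: the HONEST-SCOPE item of g37-#5 `Motives/HodgeStructureStrongCMHodgeLieRankBound`, which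
proved `2 · dim Hg(V) ≤ [F₀:ℚ]` only for STRONG CM-Hodge structures, where the centre `Z(E_φ) ≅ F₀` is a field). THEOREMS ONLY:
no definition, no named fact (D-0026 net debt `0`), no instance, no notation.

## The sources, verbatim

* J. S. Milne, *Lefschetz classes on abelian varieties*, Duke Math. J. **96** (1999) [Milne1999LefschetzClasses], §1 p. 645: «let
  `C₀(A)` be the centre of the `ℚ`-algebra `End⁰(A)` — it is a product of fields, each of which is either a CM-field or `ℚ`. Every
  Rosati involution `†` preserves each factor of `C₀(A)` and acts on it as complex conjugation. Define `S₀(A)` to be the algebraic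
  group over `ℚ` such that … `S₀(A)(R) = {γ ∈ C₀(A) ⊗_ℚ R | γ†γ = 1}`»; §4 p. 660: «`L(A) ⊃ Hg(A)`».
* M. Green, P. Griffiths, M. Kerr, *Mumford–Tate Groups and Domains* [GreenGriffithsKerr2012], §V.D p. 164: «the always satisfied
  inequality `dim(M_φ̃) ≤ ½ rk(V) + 1` [equivalently, `dim(M_φ) ≤ ½ rk(V)`]» (for an irreducible SCMpHS, where `rk V = [F₀:ℚ] =
  dim Z(E_φ)`).
* P. Deligne, *Hodge cycles on abelian varieties* [Deligne1982HodgeCycles], I Prop. 3.6: `𝔥 ⊂ 𝔰𝔭(V, ψ)` (the tree's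
  `Polarization.adjoint_eq_neg_of_mem_hodgeLie`).

## The mechanism

For a polarizable `H` with `𝔥 = Lie Hg(V) ⊂ E_φ` (`hodgeLie ≤ endAlg`, the tree's CM notion — `Motives/HodgeGroupCommutativeIffCM`):
`𝔥` commutes with `E_φ` (`E_φ` is the commutant of `𝔥`), so `𝔥 ⊂ Z(E_φ) =: Z`; the Rosati involution `†` of a polarization `ψ`
preserves `Z` (`Polarization.adjointEndAlg_mem_center`) and is MULTIPLICATIVE there (an anti-automorphism on a commutative algebra),
an involutive `ℚ`-algebra automorphism `τ` of `Z` with `𝔥 ⊂ Z^{τ = −1}` (`z† = −z` on `𝔥`). `Z` is REDUCED: for `z ∈ Z` with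
`z² = 0`, `y = z† z` has `y† y = z† z† z z = 0`, so `y = 0` and then `z = 0` by positivity (`Polarization.eq_zero_of_adjoint_mul_self`,
twice). §1 is the pure algebra: for a reduced commutative finite-dimensional `k`-algebra `R` and an algebra endomorphism `τ`,
`dim R^{τ=−1} ≤ dim R^{τ=1}` (the `R^{τ=1}`-module `R^{τ=−1}` is cyclic — proved through the idempotents of the reduced artinian
ring `R^{τ=1} ≅ ∏ K_j`, Mathlib's `IsArtinianRing.equivPi`), hence `2 dim R^{τ=−1} ≤ dim R` for an involution (with the tree's
`Sym ⊕ Skew` count `finrank_symmSubmodule_add_finrank_skewSubmodule`, Knus–Merkurjev–Rost–Tignol §2.A).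

## What is proved

* §1 (commutative algebra; `k` a field, `R` a reduced commutative finite-dimensional `k`-algebra, `τ : R →ₐ[k] R`; `Sym`/`Skew` the
  tree's `symmSubmodule`/`skewSubmodule`): **`finrank_skewSubmodule_le_finrank_symmSubmodule_of_isReduced`**
  (`dim Skew(R, τ) ≤ dim Sym(R, τ)`), **`two_mul_finrank_skewSubmodule_le_finrank_of_isReduced`** (`τ² = 1`, char `0`:
  `2 dim Skew ≤ dim R`, with the tree's `finrank_symmSubmodule_add_finrank_skewSubmodule`),
  `two_mul_finrank_le_finrank_of_injective_of_map_eq_neg` (`2 dim M ≤ dim R` for `M ↪ Skew(R, τ)`).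
* §2 (Hodge; `ψ : Polarization H`): `Polarization.isReduced_center_endAlg` (`Z(E_φ)` is reduced),
  `Polarization.exists_algHom_center_endAlg_eq_adjoint` (`†|_Z` is an involutive `ℚ`-algebra automorphism of `Z(E_φ)`),
  `mem_center_endAlg_of_mem_hodgeLie` (`𝔥 ⊂ E_φ ⟹ 𝔥 ⊂ Z(E_φ)`),
  **`Polarization.two_mul_finrank_hodgeLie_le_finrank_center_endAlg`** (`𝔥 ⊂ E_φ ⟹ 2 · dim Hg(V) ≤ dim_ℚ Z(E_φ)`),
  `two_mul_finrank_hodgeLie_le_finrank_center_endAlg_of_isPolarizable`, **`two_mul_mtRank_le_finrank_center_endAlg_add_two`**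
  (`2 · dim M_φ̃ ≤ dim Z(E_φ) + 2`, weight `≠ 0`).
* §3 (with Shimura §5.1 Prop. 1 = the tree's `Subalgebra.finrank_le_of_commutative_of_isReduced`):
  `Polarization.finrank_center_endAlg_le_finrank` (`dim Z(E_φ) ≤ rk V`),
  **`Polarization.two_mul_finrank_hodgeLie_le_finrank_of_hodgeLie_le_endAlg`** («`dim M_φ ≤ ½ rk V`» for EVERY polarizable
  CM-Hodge structure), `…_of_isPolarizable`, `Polarization.two_mul_mtRank_le_finrank_add_two_of_hodgeLie_le_endAlg`.

## References

* [Milne1999LefschetzClasses] J. S. Milne, *Lefschetz classes on abelian varieties*, Duke Math. J. 96 (1999) 639–675: §1 p. 645, §4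
  p. 660.
* [GreenGriffithsKerr2012] M. Green, P. Griffiths, M. Kerr, *Mumford–Tate Groups and Domains*, Ann. of Math. Stud. 183 (2012): §V.D
  p. 164.
* [Deligne1982HodgeCycles] P. Deligne, *Hodge cycles on abelian varieties*, in LNM 900 (1982): I Prop. 3.6.
* [Moonen2017FamiliesMotives] B. Moonen, *Families of motives and the Mumford–Tate conjecture* (2017): §2.1 (positivity of `†`).
* [KnusEtAl1998] M.-A. Knus, A. Merkurjev, M. Rost, J.-P. Tignol, *The Book of Involutions*, AMS Colloq. Publ. 44 (1998): §2.A p. 14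
  (`Sym(A, σ)`, `Skew(A, σ)`, `A = Sym ⊕ Skew`).
* [Shimura1998] G. Shimura, *Abelian Varieties with Complex Multiplication and Modular Functions*, Princeton (1998): §5.1
  Proposition 1 («[𝔖 : ℚ] ≤ 2n»).
-/

noncomputable section

open Module
open Literature.RingTheory.CentralSimple (symmSubmodule skewSubmodule mem_symmSubmodule_iff mem_skewSubmodule_iff
  finrank_symmSubmodule_add_finrank_skewSubmodule)

namespace Literature.AlgebraicGeometry.Motives

universe u

/-! ## §1 Commutative algebra: `dim R^{τ=−1} ≤ dim R^{τ=1}` for a reduced commutative finite-dimensional algebra -/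

section CommutativeAlgebra

/-- A reduced commutative artinian ring `P ≅ ∏_j K_j` (Mathlib's `IsArtinianRing.equivPi`) carries the complete system of orthogonal
idempotents `e_j ↔ (0,…,1,…,0)`, and each corner `e_j P ≅ K_j` is a field: a non-zero `u = e_j u` has `v` with `v u = e_j`. [folklore] -/
private theorem exists_orth_idem_g38h (P : Type u) [CommRing P] [IsArtinianRing P] [IsReduced P] :
    ∃ (ι : Type u) (_ : Fintype ι) (e : ι → P), (∑ j, e j = 1) ∧ (∀ j, e j * e j = e j) ∧
      (∀ i j, i ≠ j → e i * e j = 0) ∧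
      ∀ j (u : P), e j * u = u → u ≠ 0 → ∃ v : P, v * u = e j := by
  classical
  letI : ∀ m : MaximalSpectrum P, Field (P ⧸ m.asIdeal) := fun m => Ideal.Quotient.field m.asIdeal
  haveI : Fintype (MaximalSpectrum P) := Fintype.ofFinite _
  set Φ := IsArtinianRing.equivPi P with hΦ
  refine ⟨MaximalSpectrum P, inferInstance, fun j => Φ.symm (Pi.single j 1), ?_, ?_, ?_, ?_⟩
  · rw [← map_sum, Finset.univ_sum_single (fun _ : MaximalSpectrum P => (1 : _))]
    exact map_one Φ.symm
  · intro j
    rw [← map_mul]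
    congr 1
    ext m
    rw [Pi.mul_apply]
    by_cases hm : m = j
    · subst hm
      rw [Pi.single_eq_same, mul_one]
    · rw [Pi.single_eq_of_ne hm, mul_zero]
  · intro i j hij
    rw [← map_mul, ← map_zero Φ.symm]
    congr 1
    ext m
    rw [Pi.mul_apply, Pi.zero_apply]
    by_cases hm : m = i
    · subst hm
      rw [Pi.single_eq_of_ne hij, mul_zero]
    · rw [Pi.single_eq_of_ne hm, zero_mul]
  · intro j u hu hu0
    have hU : ∀ m, m ≠ j → Φ u m = 0 := fun m hm => by
      have h := congrArg (fun x => Φ x m) hu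
      simp only at h
      rw [map_mul, AlgEquiv.apply_symm_apply, Pi.mul_apply, Pi.single_eq_of_ne hm, zero_mul] at h
      exact h.symm
    have hUj : Φ u j ≠ 0 := fun h0 => hu0 (Φ.injective (by
      rw [map_zero]
      ext m
      by_cases hm : m = j
      · rw [hm, h0, Pi.zero_apply]
      · rw [hU m hm, Pi.zero_apply]))
    refine ⟨Φ.symm (Pi.single j (Φ u j)⁻¹), Φ.injective ?_⟩
    rw [map_mul, AlgEquiv.apply_symm_apply, AlgEquiv.apply_symm_apply]
    ext m
    rw [Pi.mul_apply]
    by_cases hm : m = j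
    · subst hm
      rw [Pi.single_eq_same, Pi.single_eq_same]
      exact inv_mul_cancel₀ hUj
    · rw [Pi.single_eq_of_ne hm, Pi.single_eq_of_ne hm, zero_mul]

variable {k : Type*} [Field k] {R : Type u} [CommRing R] [Algebra k R]

/-- **`dim Skew(R, τ) ≤ dim Sym(R, τ)` for an algebra endomorphism `τ` of a REDUCED commutative finite-dimensional algebra `R`** over a
field `k` (any characteristic, `τ` not even assumed involutive; `Sym`/`Skew` are the tree's `symmSubmodule`/`skewSubmodule` of
`RingTheory/CentralSimple/AlbertTypesSymmetricElements`) — the linear algebra of Milne's «`C₀(A)` is a product of fields …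
`†` preserves each factor and acts on it as complex conjugation» (so that `dim U(C₀, †) ≤ ½ dim C₀`): `R⁻ = {τ x = −x}` is a
module over the fixed algebra `R⁺`, `R⁻ · R⁻ ⊂ R⁺`, and a non-zero `w ∈ R⁻` has `w² ≠ 0` (reducedness); over the product of fields
`R⁺ = ∏ e_j R⁺` each corner `e_j R⁻` is then an `e_j R⁺`-line (`w' = (v · w w') w` with `v w² = e_j`), so `R⁻ = R⁺ · w₀` is CYCLIC for
`w₀ = Σ_j w_j`, whence `dim_k R⁻ ≤ dim_k R⁺`. [cite: Milne1999LefschetzClasses, §1 p. 645 («C₀(A) … is a product of fields, each of which is either a CM-field or ℚ. Every Rosati involution † preserves each factor of C₀(A) and acts on it as complex conjugation»)]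
[cite: KnusEtAl1998, §2.A p. 14 (`Sym(A, σ)`, `Skew(A, σ)`)] -/
theorem finrank_skewSubmodule_le_finrank_symmSubmodule_of_isReduced [Module.Finite k R] [IsReduced R] (τ : R →ₐ[k] R) :
    finrank k (skewSubmodule τ.toLinearMap) ≤ finrank k (symmSubmodule τ.toLinearMap) := by
  classical
  set N := skewSubmodule τ.toLinearMap with hNdef
  set P := AlgHom.equalizer τ (AlgHom.id k R) with hPdef
  have hN : ∀ {w : R}, w ∈ N ↔ τ w = -w := by
    intro w
    rw [hNdef, mem_skewSubmodule_iff, AlgHom.toLinearMap_apply]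
  have hPsymm : Subalgebra.toSubmodule P = symmSubmodule τ.toLinearMap := by
    ext a
    rw [Subalgebra.mem_toSubmodule, mem_symmSubmodule_iff, AlgHom.toLinearMap_apply]
    exact AlgHom.mem_equalizer _ _ _
  rw [← hPsymm]
  have hP : ∀ {a : R}, a ∈ P ↔ τ a = a := by
    intro a
    exact AlgHom.mem_equalizer _ _ _
  have hPN : ∀ {a w : R}, a ∈ P → w ∈ N → a * w ∈ N := fun ha hw => by
    rw [hN] at hw ⊢
    rw [map_mul, hP.1 ha, hw, mul_neg]
  have hNN : ∀ {w w' : R}, w ∈ N → w' ∈ N → w * w' ∈ P := fun hw hw' => by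
    rw [hN] at hw hw'
    rw [hP, map_mul, hw, hw', neg_mul_neg]
  have hred : ∀ {w : R}, w ≠ 0 → w * w ≠ 0 := fun h0 hsq =>
    h0 (IsReduced.eq_zero _ ⟨2, by rw [pow_two]; exact hsq⟩)
  -- structure on `P`
  haveI : Module.Finite k P := Module.Finite.of_injective (Subalgebra.toSubmodule P).subtype Subtype.val_injective
  haveI : IsArtinianRing P := IsArtinianRing.of_finite k P
  haveI : IsReduced P := isReduced_of_injective P.val Subtype.val_injective
  obtain ⟨ι, _, e, he1, hee0, he2, he3⟩ := exists_orth_idem_g38h P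
  have he1' : ∑ j, (e j : R) = 1 := by
    rw [show ∑ j, (e j : R) = ∑ j, P.val (e j) from rfl, ← map_sum, he1, map_one]
  have hee : ∀ j, (e j : R) * e j = e j := fun j => by
    have h := congrArg (Subtype.val : P → R) (hee0 j)
    rwa [Subalgebra.coe_mul] at h
  have he2' : ∀ i j, i ≠ j → (e i : R) * e j = 0 := fun i j hij => by
    have h := congrArg (Subtype.val : P → R) (he2 i j hij)
    rwa [Subalgebra.coe_mul, Subalgebra.coe_zero] at h
  -- the selected generators
  have hsel : ∀ j, ∃ w : R, w ∈ N ∧ (e j : R) * w = w ∧ ((∃ w' ∈ N, (e j : R) * w' ≠ 0) → w ≠ 0) := fun j => by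
    by_cases h : ∃ w' ∈ N, (e j : R) * w' ≠ 0
    · obtain ⟨w', hw', hne⟩ := h
      exact ⟨e j * w', hPN (e j).2 hw', by rw [← mul_assoc, hee], fun _ => hne⟩
    · exact ⟨0, N.zero_mem, mul_zero _, fun h' => absurd h' h⟩
  choose ws hws_mem hws_e hws_ne using hsel
  have hws_e' : ∀ i j, i ≠ j → (e i : R) * ws j = 0 := fun i j hij => by
    rw [← hws_e j, ← mul_assoc, he2' i j hij, zero_mul]
  -- every element of `N` is a `P`-multiple of `w₀ = ∑ ws j`
  have key : ∀ w' ∈ N, ∃ a ∈ P, a * ∑ j, ws j = w' := by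
    intro w' hw'
    have hc : ∀ j, ∃ c : R, c ∈ P ∧ (e j : R) * c = c ∧ c * ws j = (e j : R) * w' := fun j => by
      by_cases h : ∃ w'' ∈ N, (e j : R) * w'' ≠ 0
      · have hne : ws j ≠ 0 := hws_ne j h
        have hu0 : (⟨ws j * ws j, hNN (hws_mem j) (hws_mem j)⟩ : P) ≠ 0 := fun h0 =>
          hred hne (congrArg Subtype.val h0)
        have hu : e j * (⟨ws j * ws j, hNN (hws_mem j) (hws_mem j)⟩ : P) = ⟨ws j * ws j, hNN (hws_mem j) (hws_mem j)⟩ :=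
          Subtype.ext (by rw [Subalgebra.coe_mul]; exact (by rw [← mul_assoc, hws_e] : (e j : R) * (ws j * ws j) = ws j * ws j))
        obtain ⟨v, hv⟩ := he3 j _ hu hu0
        have hv' : (v : R) * (ws j * ws j) = e j := by
          have h := congrArg (Subtype.val : P → R) hv
          rwa [Subalgebra.coe_mul] at h
        refine ⟨(v : R) * (ws j * w'), P.mul_mem v.2 (hNN (hws_mem j) hw'), ?_, ?_⟩
        · rw [mul_left_comm, ← mul_assoc (e j : R) (ws j) w', hws_e j]
        · calc (v : R) * (ws j * w') * ws j = (v : R) * (ws j * ws j) * w' := by ring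
            _ = (e j : R) * w' := by rw [hv']
      · have h' : (e j : R) * w' = 0 := by
          by_contra hc
          exact h ⟨w', hw', hc⟩
        exact ⟨0, P.zero_mem, mul_zero _, by rw [zero_mul, h']⟩
    choose c hcP hce hcw using hc
    refine ⟨∑ j, c j, P.sum_mem fun j _ => hcP j, ?_⟩
    rw [Finset.sum_mul]
    have hj : ∀ j, c j * ∑ i, ws i = (e j : R) * w' := fun j => by
      rw [Finset.mul_sum, Finset.sum_eq_single j]
      · exact hcw j
      · intro i _ hij
        rw [← hce j, mul_comm (e j : R) (c j), mul_assoc, hws_e' j i (Ne.symm hij), mul_zero]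
      · intro hj
        exact absurd (Finset.mem_univ j) hj
    simp_rw [hj]
    rw [← Finset.sum_mul, he1', one_mul]
  have hle : N ≤ (Subalgebra.toSubmodule P).map (LinearMap.mulRight k (∑ j, ws j)) := fun w' hw' => by
    obtain ⟨a, ha, haw⟩ := key w' hw'
    exact ⟨a, ha, haw⟩
  exact (Submodule.finrank_mono hle).trans (Submodule.finrank_map_le _ _)

/-- **`2 · dim Skew(R, τ) ≤ dim R` for an involution `τ` of a reduced commutative finite-dimensional algebra** in characteristic
`0` (`dim Sym + dim Skew = dim R`, the tree's `finrank_symmSubmodule_add_finrank_skewSubmodule` of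
`RingTheory/CentralSimple/AlbertTypesSymmetricElements`): «`dim U(C₀, †) ≤ ½ dim C₀`» at the Lie-algebra level.
[cite: Milne1999LefschetzClasses, §1 p. 645] [cite: KnusEtAl1998, §2.A p. 14 («A = Sym(A, σ) ⊕ Skew(A, σ)»)] -/
theorem two_mul_finrank_skewSubmodule_le_finrank_of_isReduced [CharZero k] [Module.Finite k R] [IsReduced R]
    (τ : R →ₐ[k] R) (hτ : ∀ x, τ (τ x) = x) :
    2 * finrank k (skewSubmodule τ.toLinearMap) ≤ finrank k R := by
  have h := finrank_skewSubmodule_le_finrank_symmSubmodule_of_isReduced τ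
  have h' := finrank_symmSubmodule_add_finrank_skewSubmodule (ι := τ.toLinearMap) hτ
  omega

/-- **`2 · dim M ≤ dim R` for every `k`-space `M` embedded in the skew part `Skew(R, τ)` of an involution `τ`** of a reduced
commutative finite-dimensional algebra `R` in characteristic `0` (the form used in §2: `M = 𝔥`, `R = Z(E_φ)`).
[cite: Milne1999LefschetzClasses, §1 p. 645 and §4 p. 660] [cite: KnusEtAl1998, §2.A p. 14] -/
theorem two_mul_finrank_le_finrank_of_injective_of_map_eq_neg [CharZero k] [Module.Finite k R] [IsReduced R]
    (τ : R →ₐ[k] R) (hτ : ∀ x, τ (τ x) = x) {M : Type*} [AddCommGroup M] [Module k M] (θ : M →ₗ[k] R)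
    (hθ : Function.Injective θ) (hθτ : ∀ m, τ (θ m) = -θ m) : 2 * finrank k M ≤ finrank k R := by
  have hrange : LinearMap.range θ ≤ skewSubmodule τ.toLinearMap := by
    rintro _ ⟨m, rfl⟩
    rw [mem_skewSubmodule_iff, AlgHom.toLinearMap_apply, hθτ]
  calc 2 * finrank k M = 2 * finrank k (LinearMap.range θ) := by rw [LinearMap.finrank_range_of_inj hθ]
    _ ≤ 2 * finrank k (skewSubmodule τ.toLinearMap) := Nat.mul_le_mul_left 2 (Submodule.finrank_mono hrange)
    _ ≤ finrank k R := two_mul_finrank_skewSubmodule_le_finrank_of_isReduced τ hτ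

end CommutativeAlgebra

/-! ## §2 The Hodge application: `𝔥 ⊂ Z(E_φ)^{†=−1}` and `2 · dim Hg(V) ≤ dim Z(E_φ)` for a polarizable CM-Hodge structure -/

namespace HodgeStructure

variable {V : Type u} [AddCommGroup V] [Module ℚ V] [Module.Finite ℚ V] [HodgeTensorFacts.{u, u}] {n : ℤ}
  {H : HodgeStructure V n}

omit [HodgeTensorFacts.{u, u}] in
/-- **The centre `Z(E_φ)` of the endomorphism algebra of a polarizable Hodge structure is REDUCED**: if `z ∈ Z(E_φ)` has `z² = 0`
then `y = z† z ∈ E_φ` has `y† y = z† z† z z = 0`, so `y = 0`, so `z = 0` — positivity of the Rosati involution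
(`Polarization.eq_zero_of_adjoint_mul_self`) used twice. («`C₀(A)` … is a product of fields».)
[cite: Milne1999LefschetzClasses, §1 p. 645] [cite: Moonen2017FamiliesMotives, §2.1 (p. 3)] -/
theorem Polarization.isReduced_center_endAlg (ψ : Polarization H) : IsReduced (Subalgebra.center ℚ H.endAlg) := by
  refine (isReduced_iff_pow_one_lt 2 one_lt_two).2 fun z hz => ?_
  have ha : ((z : H.endAlg) : Module.End ℚ V) ∈ H.endAlg := (z : H.endAlg).2
  have haa : ((z : H.endAlg) : Module.End ℚ V) * ((z : H.endAlg) : Module.End ℚ V) = 0 := by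
    have h := congrArg (fun w : Subalgebra.center ℚ H.endAlg => ((w : H.endAlg) : Module.End ℚ V)) hz
    simpa only [pow_two, Subalgebra.coe_mul, Subalgebra.coe_zero] using h
  have hcomm : ((z : H.endAlg) : Module.End ℚ V) * ψ.adjoint ((z : H.endAlg) : Module.End ℚ V) =
      ψ.adjoint ((z : H.endAlg) : Module.End ℚ V) * ((z : H.endAlg) : Module.End ℚ V) := by
    have h := Subalgebra.mem_center_iff.1 z.2 ⟨ψ.adjoint ((z : H.endAlg) : Module.End ℚ V), ψ.adjoint_mem_endAlg ha⟩
    exact (congrArg Subtype.val h).symm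
  have hy : ψ.adjoint ((z : H.endAlg) : Module.End ℚ V) * ((z : H.endAlg) : Module.End ℚ V) = 0 := by
    refine ψ.eq_zero_of_adjoint_mul_self (H.endAlg.mul_mem (ψ.adjoint_mem_endAlg ha) ha) ?_
    rw [ψ.adjoint_mul, ψ.adjoint_adjoint, mul_assoc, ← mul_assoc ((z : H.endAlg) : Module.End ℚ V), hcomm, mul_assoc,
      haa, mul_zero, mul_zero]
  exact Subtype.ext (Subtype.ext (ψ.eq_zero_of_adjoint_mul_self ha hy))

omit [HodgeTensorFacts.{u, u}] in
/-- **The Rosati involution restricted to the centre is an involutive `ℚ`-algebra automorphism `τ` of `Z(E_φ)`** (`†` is an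
anti-automorphism of `E_φ` preserving the centre, `Polarization.adjointEndAlg_mem_center`, and `Z(E_φ)` is commutative).
[cite: Milne1999LefschetzClasses, §1 p. 645 («† preserves each factor of C₀(A)»)] [cite: Moonen2017FamiliesMotives, §2.1 (p. 3)] -/
theorem Polarization.exists_algHom_center_endAlg_eq_adjoint (ψ : Polarization H) :
    ∃ τ : Subalgebra.center ℚ H.endAlg →ₐ[ℚ] Subalgebra.center ℚ H.endAlg,
      (∀ z, (((τ z : Subalgebra.center ℚ H.endAlg) : H.endAlg) : Module.End ℚ V) =
        ψ.adjoint ((z : H.endAlg) : Module.End ℚ V)) ∧ ∀ z, τ (τ z) = z := by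
  let f : Subalgebra.center ℚ H.endAlg →ₗ[ℚ] Subalgebra.center ℚ H.endAlg :=
    { toFun := fun z => ⟨ψ.adjointEndAlg (z : H.endAlg), ψ.adjointEndAlg_mem_center z.2⟩
      map_add' := fun z w => Subtype.ext (by simp only [Subalgebra.coe_add, map_add])
      map_smul' := fun c z => Subtype.ext (by simp only [Subalgebra.coe_smul, map_smul, RingHom.id_apply]) }
  have hf : ∀ z, (((f z : Subalgebra.center ℚ H.endAlg) : H.endAlg) : Module.End ℚ V) =
      ψ.adjoint ((z : H.endAlg) : Module.End ℚ V) := fun z => rfl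
  have h1 : f 1 = 1 := Subtype.ext (Subtype.ext (by rw [hf]; exact ψ.adjoint_one))
  have hmul : ∀ x y, f (x * y) = f x * f y := fun x y => by
    refine Subtype.ext (Subtype.ext ?_)
    rw [hf, Subalgebra.coe_mul, Subalgebra.coe_mul, Subalgebra.coe_mul, Subalgebra.coe_mul, hf, hf, ψ.adjoint_mul]
    have h := Subalgebra.mem_center_iff.1 (f x).2 ((f y : Subalgebra.center ℚ H.endAlg) : H.endAlg)
    have h' := congrArg Subtype.val h
    rw [Subalgebra.coe_mul, Subalgebra.coe_mul, hf, hf] at h'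
    exact h'
  refine ⟨AlgHom.ofLinearMap f h1 hmul, fun z => hf z, fun z => Subtype.ext (Subtype.ext ?_)⟩
  rw [AlgHom.ofLinearMap_apply, AlgHom.ofLinearMap_apply, hf, hf, ψ.adjoint_adjoint]

omit [Module.Finite ℚ V] [HodgeTensorFacts.{u, u}] in
/-- **`𝔥 ⊂ E_φ ⟹ 𝔥 ⊂ Z(E_φ)`**: the Hodge Lie algebra of a CM-Hodge structure (tree notion `hodgeLie ≤ endAlg`) lies in the CENTRE of
the endomorphism algebra, `E_φ` being the commutant of `𝔥` (`forall_commute_endAlg_of_mem_hodgeLie`).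
[cite: Milne1999LefschetzClasses, §4 p. 660 («L(A) ⊃ Hg(A)»)] [cite: Deligne1982HodgeCycles, I Prop. 3.6] -/
theorem mem_center_endAlg_of_mem_hodgeLie [Module.Finite ℚ V] [HodgeTensorFacts.{u, u}]
    (hCM : H.hodgeLie ≤ Subalgebra.toSubmodule H.endAlg) {X : Module.End ℚ V} (hX : X ∈ H.hodgeLie) :
    (⟨X, hCM hX⟩ : H.endAlg) ∈ Subalgebra.center ℚ H.endAlg :=
  Subalgebra.mem_center_iff.2 fun b => Subtype.ext ((forall_commute_endAlg_of_mem_hodgeLie hX b b.2).symm)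

/-- **`2 · dim Hg(V) ≤ dim_ℚ Z(E_φ)` FOR EVERY POLARIZABLE CM-HODGE STRUCTURE** (`𝔥 = Lie Hg(V) ⊂ E_φ`): `𝔥 ⊂ Z(E_φ)^{†=−1}` and
`Z(E_φ)` is a reduced commutative algebra with the involution `†` (§1). For a STRONG CM-Hodge structure `Z(E_φ) ≅ F₀` and this is
g37-#5 `two_mul_finrank_hodgeLie_le_finrank_centralSubfield`; in general `Z(E_φ)` is a product of fields.
[cite: Milne1999LefschetzClasses, §1 p. 645 and §4 p. 660] [cite: GreenGriffithsKerr2012, §V.D p. 164 («the always satisfied inequality»)]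
[cite: Deligne1982HodgeCycles, I Prop. 3.6] -/
theorem Polarization.two_mul_finrank_hodgeLie_le_finrank_center_endAlg (ψ : Polarization H)
    (hCM : H.hodgeLie ≤ Subalgebra.toSubmodule H.endAlg) :
    2 * finrank ℚ H.hodgeLie ≤ finrank ℚ (Subalgebra.center ℚ H.endAlg) := by
  haveI : IsReduced (Subalgebra.center ℚ H.endAlg) := ψ.isReduced_center_endAlg
  haveI : Module.Finite ℚ (Subalgebra.center ℚ H.endAlg) := finite_center_endAlg H
  obtain ⟨τ, hτ, hττ⟩ := ψ.exists_algHom_center_endAlg_eq_adjoint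
  -- `𝔥 ↪ Z(E_φ)^{τ = −1}`
  let θ : H.hodgeLie →ₗ[ℚ] Subalgebra.center ℚ H.endAlg :=
    { toFun := fun X => ⟨⟨(X : Module.End ℚ V), hCM X.2⟩, mem_center_endAlg_of_mem_hodgeLie hCM X.2⟩
      map_add' := fun X Y => Subtype.ext (Subtype.ext rfl)
      map_smul' := fun c X => Subtype.ext (Subtype.ext rfl) }
  have hθv : ∀ X : H.hodgeLie, (((θ X : Subalgebra.center ℚ H.endAlg) : H.endAlg) : Module.End ℚ V) = X := fun X => rfl
  have hθ : Function.Injective θ := fun X Y h => Subtype.ext (by rw [← hθv X, ← hθv Y, h])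
  have hθτ : ∀ X, τ (θ X) = -θ X := fun X => by
    refine Subtype.ext (Subtype.ext ?_)
    rw [hτ, Subalgebra.coe_neg, Subalgebra.coe_neg, hθv]
    exact ψ.adjoint_eq_neg_of_mem_hodgeLie X.2
  exact two_mul_finrank_le_finrank_of_injective_of_map_eq_neg (k := ℚ) (R := Subalgebra.center ℚ H.endAlg)
    (M := H.hodgeLie) τ hττ θ hθ hθτ

/-- The same from `IsPolarizable`. [cite: Milne1999LefschetzClasses, §1 p. 645 and §4 p. 660] [cite: GreenGriffithsKerr2012, §V.D p. 164] -/
theorem two_mul_finrank_hodgeLie_le_finrank_center_endAlg_of_isPolarizable (hH : H.IsPolarizable)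
    (hCM : H.hodgeLie ≤ Subalgebra.toSubmodule H.endAlg) :
    2 * finrank ℚ H.hodgeLie ≤ finrank ℚ (Subalgebra.center ℚ H.endAlg) := by
  obtain ⟨ψ⟩ := hH
  exact ψ.two_mul_finrank_hodgeLie_le_finrank_center_endAlg hCM

/-- **`2 · dim M_φ̃(V) ≤ dim_ℚ Z(E_φ) + 2`** for a polarizable CM-Hodge structure of weight `≠ 0` on `V ≠ 0`
(`dim M_φ̃ = dim Hg + 1`, `mtRank_eq_finrank_hodgeLie_add_one`). [cite: GreenGriffithsKerr2012, §V.D p. 164 («dim(M_φ̃) ≤ ½ rk(V) + 1»)]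
[cite: Milne1999LefschetzClasses, §1 p. 645] -/
theorem Polarization.two_mul_mtRank_le_finrank_center_endAlg_add_two [Nontrivial V] (ψ : Polarization H) (hn : n ≠ 0)
    (hCM : H.hodgeLie ≤ Subalgebra.toSubmodule H.endAlg) :
    2 * H.mtRank ≤ finrank ℚ (Subalgebra.center ℚ H.endAlg) + 2 := by
  rw [mtRank_eq_finrank_hodgeLie_add_one H ψ hn]
  have h := ψ.two_mul_finrank_hodgeLie_le_finrank_center_endAlg hCM
  omega

/-! ## §3 «`dim M_φ ≤ ½ rk V`» for EVERY polarizable CM-Hodge structure: `dim_ℚ Z(E_φ) ≤ rk V` (Shimura §5.1 Prop. 1) -/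

omit [HodgeTensorFacts.{u, u}] in
/-- **`dim_ℚ Z(E_φ) ≤ rk V` for a polarizable Hodge structure**: the centre of `E_φ` is a commutative REDUCED subalgebra of
`End_ℚ V` (§2 `isReduced_center_endAlg`), so Shimura's «`[𝔖 : ℚ] ≤ 2n` for a commutative semi-simple `𝔖 ⊂ End_ℚ(A)`» applies
(the tree's `Subalgebra.finrank_le_of_commutative_of_isReduced`, `RingTheory/ZeroDimensional/FaithfulModuleDegreeBound`).
[cite: Shimura1998, §5.1 Proposition 1] [cite: Milne1999LefschetzClasses, §1 p. 645] -/
theorem Polarization.finrank_center_endAlg_le_finrank (ψ : Polarization H) :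
    finrank ℚ (Subalgebra.center ℚ H.endAlg) ≤ finrank ℚ V := by
  haveI : IsReduced (Subalgebra.center ℚ H.endAlg) := ψ.isReduced_center_endAlg
  set T : Subalgebra ℚ (Module.End ℚ V) := (Subalgebra.center ℚ H.endAlg).map H.endAlg.val with hT
  have e : Subalgebra.center ℚ H.endAlg ≃ₐ[ℚ] T :=
    Subalgebra.equivMapOfInjective (Subalgebra.center ℚ H.endAlg) H.endAlg.val Subtype.val_injective
  haveI : IsReduced T := isReduced_of_injective e.symm.toRingEquiv.toRingHom e.symm.injective
  have hcomm : ∀ x ∈ T, ∀ y ∈ T, x * y = y * x := by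
    rintro _ ⟨a, ha, rfl⟩ _ ⟨b, hb, rfl⟩
    have h := Subalgebra.mem_center_iff.1 ha b
    exact (congrArg Subtype.val h).symm
  rw [e.toLinearEquiv.finrank_eq]
  exact Literature.RingTheory.ZeroDimensional.Subalgebra.finrank_le_of_commutative_of_isReduced T hcomm

/-- **«The always satisfied inequality `dim(M_φ) ≤ ½ rk(V)`» FOR EVERY POLARIZABLE CM-HODGE STRUCTURE** (tree notion
`hodgeLie ≤ endAlg`), not only strong / irreducible ones: `2 · dim Hg(V) ≤ dim_ℚ Z(E_φ) ≤ rk V` (§2 with Shimura's bound §3;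
g37-#5 `two_mul_finrank_hodgeLie_le_finrank` is the SCMHS case). [cite: GreenGriffithsKerr2012, §V.D p. 164 («the always satisfied inequality … dim(M_φ) ≤ ½ rk(V)»)]
[cite: Milne1999LefschetzClasses, §1 p. 645 and §4 p. 660] [cite: Shimura1998, §5.1 Proposition 1] -/
theorem Polarization.two_mul_finrank_hodgeLie_le_finrank_of_hodgeLie_le_endAlg (ψ : Polarization H)
    (hCM : H.hodgeLie ≤ Subalgebra.toSubmodule H.endAlg) : 2 * finrank ℚ H.hodgeLie ≤ finrank ℚ V :=
  (ψ.two_mul_finrank_hodgeLie_le_finrank_center_endAlg hCM).trans ψ.finrank_center_endAlg_le_finrank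

/-- The same from `IsPolarizable`. [cite: GreenGriffithsKerr2012, §V.D p. 164] [cite: Shimura1998, §5.1 Proposition 1] -/
theorem two_mul_finrank_hodgeLie_le_finrank_of_hodgeLie_le_endAlg_of_isPolarizable (hH : H.IsPolarizable)
    (hCM : H.hodgeLie ≤ Subalgebra.toSubmodule H.endAlg) : 2 * finrank ℚ H.hodgeLie ≤ finrank ℚ V := by
  obtain ⟨ψ⟩ := hH
  exact ψ.two_mul_finrank_hodgeLie_le_finrank_of_hodgeLie_le_endAlg hCM

/-- **«`dim(M_φ̃) ≤ ½ rk(V) + 1`» for every polarizable CM-Hodge structure of weight `≠ 0`**: `2 · dim M_φ̃(V) ≤ rk V + 2`.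
[cite: GreenGriffithsKerr2012, §V.D p. 164 («dim(M_φ̃) ≤ ½ rk(V) + 1»)] [cite: Shimura1998, §5.1 Proposition 1] -/
theorem Polarization.two_mul_mtRank_le_finrank_add_two_of_hodgeLie_le_endAlg [Nontrivial V] (ψ : Polarization H)
    (hn : n ≠ 0) (hCM : H.hodgeLie ≤ Subalgebra.toSubmodule H.endAlg) : 2 * H.mtRank ≤ finrank ℚ V + 2 := by
  rw [mtRank_eq_finrank_hodgeLie_add_one H ψ hn]
  have h := ψ.two_mul_finrank_hodgeLie_le_finrank_of_hodgeLie_le_endAlg hCM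
  omega

end HodgeStructure

end Literature.AlgebraicGeometry.Motives

end
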